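import Literature.AnabelianGeometry.EtaleTheta.SettingModel2Inversion
import HarnessLib

/-!
# The inversion preserves the covering tower `Y_N`, `Z_N`, `Ÿ` of both root models of [EtTh] §1

S. Mochizuki, *The étale theta function and its Frobenioid-theoretic manifestations*, Publ. RIMS **45** (2009) [EtTh], §1
pp. 13–14, 17 (PRIMS pp. 239–240, 243): the coverings `Y_N → Y → X`, `Z_N → Y_N`, `Ÿ = Y₂` defined through `Π^tp_X ↠ Z` and
the class-2 quotient; §2 p. 36 / Prop. 2.2 (i) p. 37 (the inversion `ι`, eigenvalues `−1` on `Δ̄^ell`, `+1` on `Δ̄_Θ`);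
[IUTchII] Rmk. 1.4.1 (ii) p. 28 (the pointed inversion `ι_X` and its lift `ι_Ÿ` to the double covering).
[cite: MochizukiEtTh2009, §1 p.13]

Cell abc-iut, seat abc-iut-w5-d072 (gen 3; (R1) ι-datum custody, GAP G-w4d010-2 / D-G-w4d010-2h). Completes the inversion
profiles of the discrete root model (`SettingModelInversion.lean`, p424489) and of the finer root model
(`SettingModel2Inversion.lean`): the pointed inversion carries EVERY covering of the §1 tower onto itself — the root-level
shadow of «`ι_X` lifts to `ι_Ÿ`» ([IUTchII] Rmk. 1.4.1 (ii); the L6 closers' `iotaYddOfAut`, p418896) and of the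
`Γ(Π^tp_{Ÿα}) = Π^tp_{Ÿβ}`-type clauses of [EtTh] Prop. 1.8 / Thm. 1.6 (i) for `Γ := ι`.

* §1 `Heis.negXY : Heis R →* Heis R`, `(x, y, z) ↦ (−x, −y, z)` — the automorphism of the Heisenberg group induced by inverting
  both generators (an involution commuting with change of rings; note the `z`-coordinate is FIXED: `−1` on the abelianisation,
  `+1` on the centre, [EtTh] Prop. 2.2 (i)); `heisHom_invGenHom : heisHom ∘ σ = negXY ∘ heisHom` on `F₂`;
  `hHat_sigmaHat : ĥ_N ∘ σ̂ = negXY ∘ ĥ_N` on `F̂₂` (density).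
* §2 discrete model: `map_GtpYN_inversion`, `map_GtpZN_inversion`, `map_GtpYdd_inversion` — `ι(Π^tp_{Y_N}) = Π^tp_{Y_N}`,
  `ι(Π^tp_{Z_N}) = Π^tp_{Z_N}`, `ι(Π^tp_Ÿ) = Π^tp_Ÿ` (parities `x = 0`, `N ∣ y`, `N ∣ z` are `negXY`-invariant).
* §3 finer model: `levelHom_gfpInv`, `map_GtpYN_inversion₂`, `map_GtpZN_inversion₂`, `map_GtpYdd_inversion₂` (same, through
  the profinite level maps `ĥ_N`), and the generic `ThetaSetting.map_GtpYddN_eq_of_aug_of_GtpYN` (for ANY `ι` over `G_K`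
  preserving the `Y_N`: `ι(Π^tp_{Ÿ_N}) = Π^tp_{Ÿ_N}`).

HONEST LIMITS as in the two profile files (root-level, semi-synthetic models; no `KummerData`). One new definition (`Heis.negXY`);
no instances; no Prop facts. [EtTh] is refereed; nothing here bears on [IUTchIII] Cor. 3.12; typed ≠ proved; instantiated ≠
endorsed.
-/

noncomputable section

namespace Literature.AnabelianGeometry.EtaleTheta.SettingModel

open Literature.AnabelianGeometry.SemiGraphs
open Function
open _root_.Topology

/-! ## §1. `(x, y, z) ↦ (−x, −y, z)` on the Heisenberg group, and its compatibility with `σ`, `σ̂` -/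

namespace Heis

variable {R : Type*} [CommRing R]

/-- **The automorphism `(x, y, z) ↦ (−x, −y, z)` of `Heis R`** (inverting both generators: `−1` on the abelianisation
`(x, y)`, `+1` on the centre `z`). [cite: MochizukiEtTh2009, Prop 2.2 (i) p.37] -/
def negXY : Heis R →* Heis R where
  toFun a := ⟨-a.x, -a.y, a.z⟩
  map_one' := by ext <;> simp
  map_mul' a b := by ext <;> simp <;> ring

/-- [cite: MochizukiEtTh2009, Prop 2.2 (i) p.37] -/
@[simp] theorem negXY_x (a : Heis R) : (negXY a).x = -a.x := rfl
/-- [cite: MochizukiEtTh2009, Prop 2.2 (i) p.37] -/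
@[simp] theorem negXY_y (a : Heis R) : (negXY a).y = -a.y := rfl
/-- [cite: MochizukiEtTh2009, Prop 2.2 (i) p.37] -/
@[simp] theorem negXY_z (a : Heis R) : (negXY a).z = a.z := rfl

/-- `negXY` is an involution. [cite: MochizukiEtTh2009, Prop 2.2 (i) p.37] -/
@[simp] theorem negXY_negXY (a : Heis R) : negXY (negXY a) = a := by
  ext <;> simp

/-- `negXY` is injective. [cite: MochizukiEtTh2009, Prop 2.2 (i) p.37] -/
theorem negXY_injective : Injective (negXY (R := R)) :=
  fun a b h => by rw [← negXY_negXY a, h, negXY_negXY]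

/-- `negXY a = 1 ↔ a = 1`. [cite: MochizukiEtTh2009, Prop 2.2 (i) p.37] -/
theorem negXY_eq_one_iff (a : Heis R) : negXY a = 1 ↔ a = 1 := by
  constructor
  · intro h
    exact negXY_injective (R := R) (h.trans (negXY (R := R)).map_one.symm)
  · rintro rfl
    exact map_one _

/-- `negXY` commutes with change of rings. [cite: MochizukiEtTh2009, Prop 2.2 (i) p.37] -/
theorem map_negXY {S : Type*} [CommRing S] (f : R →+* S) (a : Heis R) : map f (negXY a) = negXY (map f a) := by
  ext <;> simp

/-- `negXY` preserves the `z`-axis `{x = y = 0}`. [cite: MochizukiEtTh2009, Prop 2.2 (i) p.37] -/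
theorem negXY_mem_zAxis_iff (a : Heis R) : negXY a ∈ zAxis ↔ a ∈ zAxis := by
  change (-a.x = 0 ∧ -a.y = 0) ↔ (a.x = 0 ∧ a.y = 0)
  rw [neg_eq_zero, neg_eq_zero]

end Heis

/-- **`heisHom (σ w) = negXY (heisHom w)`**: the inversion of `F₂` is `(x, y, z) ↦ (−x, −y, z)` on the discrete class-2 quotient
(check on generators: `a⁻¹ ↦ (−1, 0, 0)`, `b⁻¹ ↦ (0, −1, 0)`). [cite: MochizukiEtTh2009, Prop 2.2 (i) p.37] -/
theorem heisHom_invGenHom (w : F₂) : heisHom (invGenHom w) = Heis.negXY (heisHom w) := by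
  have h : heisHom.comp invGenHom = Heis.negXY.comp heisHom := by
    refine FreeGroup.ext_hom _ _ fun i => ?_
    fin_cases i
    · simp only [MonoidHom.comp_apply, invGenHom_of, map_inv, Fin.zero_eta, heisHom_of_zero]
      ext <;> simp
    · simp only [MonoidHom.comp_apply, invGenHom_of, map_inv, Fin.mk_one, heisHom_of_one]
      ext <;> simp
  exact DFunLike.congr_fun h w

/-- **`ĥ_N (σ̂ x) = negXY (ĥ_N x)`** on `F̂₂` (both sides continuous into the discrete `Heis (ℤ/N)`, equal on `η(F₂)`).
[cite: MochizukiEtTh2009, Prop 2.2 (i) p.37] -/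
theorem hHat_sigmaHat (N : ℕ+) (x : F₂hatT) : hHat N (sigmaHat x) = Heis.negXY (hHat N x) := by
  have h : (hHat N ∘ sigmaHat : F₂hatT → Heis (ZMod N)) = fun x => Heis.negXY (hHat N x) :=
    Continuous.ext_on denseRange_eta ((hHat N).continuous.comp sigmaHat.continuous)
      (continuous_of_discreteTopology.comp (hHat N).continuous)
      (by
        rintro _ ⟨g, rfl⟩
        simp only [comp_apply]
        rw [sigmaHat_eta, hHat_eta, hHat_eta, heisHom_invGenHom, Heis.map_negXY])
  exact congrFun h x

/-! ## §2. The discrete root model: `ι` preserves `Π^tp_{Y_N}`, `Π^tp_{Z_N}`, `Π^tp_Ÿ` -/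

/-- `H.map e = H` from a membership criterion. [folklore] -/
private theorem map_eq_of_mem_iff {G : Type*} [Group G] (e : G ≃* G) (H : Subgroup G)
    (h : ∀ x, e x ∈ H ↔ x ∈ H) : H.map e.toMonoidHom = H := by
  ext x
  constructor
  · rintro ⟨y, hy, rfl⟩
    exact (h y).mpr hy
  · intro hx
    exact ⟨e.symm x, (h _).mp (by rw [MulEquiv.apply_symm_apply]; exact hx), e.apply_symm_apply x⟩

/-- `σ` preserves `Δ_{Y_N} ≤ F₂` (`x = 0`, `N ∣ y` are `negXY`-invariant). [cite: MochizukiEtTh2009, §1 p.13] -/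
theorem invGenHom_mem_deltaYN_iff (N : ℕ) (w : F₂) : invGenHom w ∈ deltaYN N ↔ w ∈ deltaYN N := by
  rw [deltaYN, Subgroup.mem_comap, Subgroup.mem_comap, heisHom_invGenHom]
  change (-(heisHom w).x = 0 ∧ (N : ℤ) ∣ -(heisHom w).y) ↔ ((heisHom w).x = 0 ∧ (N : ℤ) ∣ (heisHom w).y)
  rw [neg_eq_zero, dvd_neg]

/-- `σ` preserves `Δ_{Z_N} ≤ F₂` (`x = 0`, `N ∣ y`, `N ∣ z` are `negXY`-invariant). [cite: MochizukiEtTh2009, §1 p.14] -/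
theorem invGenHom_mem_deltaZN_iff (N : ℕ) (w : F₂) : invGenHom w ∈ deltaZN N ↔ w ∈ deltaZN N := by
  rw [deltaZN, Subgroup.mem_comap, Subgroup.mem_comap, heisHom_invGenHom]
  change (-(heisHom w).x = 0 ∧ (N : ℤ) ∣ -(heisHom w).y ∧ (N : ℤ) ∣ (heisHom w).z) ↔
    ((heisHom w).x = 0 ∧ (N : ℤ) ∣ (heisHom w).y ∧ (N : ℤ) ∣ (heisHom w).z)
  rw [neg_eq_zero, dvd_neg]

variable (p : ℕ) [Fact p.Prime]

/-- **`ι(Π^tp_{Y_N}) = Π^tp_{Y_N}`** at the discrete root model. [cite: MochizukiEtTh2009, §1 p.13] -/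
theorem map_GtpYN_inversion (N : ℕ+) :
    ((ThetaSetting.model p).GtpYN N).map (inversion p).toMulEquiv.toMonoidHom = (ThetaSetting.model p).GtpYN N :=
  map_eq_of_mem_iff _ _ fun x => by
    change inversionM p x ∈ YN p N ↔ x ∈ YN p N
    rw [YN, Subgroup.mem_prod, Subgroup.mem_prod, Subgroup.mem_comap, Subgroup.mem_comap]
    have h1 : Del.val (inversionM p x).1 ∈ deltaYN N ↔ Del.val x.1 ∈ deltaYN N := by
      change Del.val (Del.inv x.1) ∈ deltaYN N ↔ _
      rw [Del.val_inv]
      exact invGenHom_mem_deltaYN_iff _ _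
    exact and_congr h1 Iff.rfl

/-- **`ι(Π^tp_{Z_N}) = Π^tp_{Z_N}`** at the discrete root model. [cite: MochizukiEtTh2009, §1 p.14] -/
theorem map_GtpZN_inversion (N : ℕ+) :
    ((ThetaSetting.model p).GtpZN N).map (inversion p).toMulEquiv.toMonoidHom = (ThetaSetting.model p).GtpZN N :=
  map_eq_of_mem_iff _ _ fun x => by
    change inversionM p x ∈ ZN p N ↔ x ∈ ZN p N
    rw [ZN, Subgroup.mem_prod, Subgroup.mem_prod, Subgroup.mem_comap, Subgroup.mem_comap]
    have h1 : Del.val (inversionM p x).1 ∈ deltaZN N ↔ Del.val x.1 ∈ deltaZN N := by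
      change Del.val (Del.inv x.1) ∈ deltaZN N ↔ _
      rw [Del.val_inv]
      exact invGenHom_mem_deltaZN_iff _ _
    exact and_congr h1 Iff.rfl

/-- **Generic**: an automorphism `ι` of `Π^tp_X` over `G_{ℚ_p}` which preserves every `Π^tp_{Y_N}` preserves every
`Π^tp_{Ÿ_N} = Π^tp_{Y_{2N}} ∩ aug⁻¹(G_{J̈_N})` (p. 17). [cite: MochizukiEtTh2009, §1 p.17] -/
theorem _root_.Literature.AnabelianGeometry.EtaleTheta.ThetaSetting.map_GtpYddN_eq_of_aug_of_GtpYN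
    {p : ℕ} [Fact p.Prime] (D : ThetaSetting p) (ι : D.PiTemp ≃ₜ* D.PiTemp) (haug : ∀ x, D.aug (ι x) = D.aug x)
    (hY : ∀ N, (D.GtpYN N).map ι.toMulEquiv.toMonoidHom = D.GtpYN N) (N : ℕ+) :
    (D.GtpYddN N).map ι.toMulEquiv.toMonoidHom = D.GtpYddN N := by
  refine map_eq_of_mem_iff ι.toMulEquiv _ fun x => ?_
  have hYmem : ι x ∈ D.GtpYN (2 * N) ↔ x ∈ D.GtpYN (2 * N) := by
    constructor
    · intro hx
      have h2 : ι x ∈ (D.GtpYN (2 * N)).map ι.toMulEquiv.toMonoidHom := by rw [hY]; exact hx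
      obtain ⟨z, hz, hzx⟩ := h2
      have hz' : z = x := ι.injective hzx
      subst hz'
      exact hz
    · intro hx
      rw [← hY (2 * N)]
      exact ⟨x, hx, rfl⟩
  change ι x ∈ D.GtpYN (2 * N) ⊓ (D.GJddN N).comap D.aug.toMonoidHom ↔ x ∈ D.GtpYN (2 * N) ⊓ (D.GJddN N).comap D.aug.toMonoidHom
  rw [Subgroup.mem_inf, Subgroup.mem_inf, Subgroup.mem_comap, Subgroup.mem_comap]
  exact and_congr hYmem (by change D.aug (ι x) ∈ _ ↔ D.aug x ∈ _; rw [haug])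

/-- **`ι(Π^tp_Ÿ) = Π^tp_Ÿ`** at the discrete root model («`ι_X` lifts to `ι_Ÿ`», [IUTchII] Rmk. 1.4.1 (ii)).
[cite: Mochizuki2012, Rmk 1.4.1 (ii) p.28] -/
theorem map_GtpYdd_inversion :
    (ThetaSetting.model p).GtpYdd.map (inversion p).toMulEquiv.toMonoidHom = (ThetaSetting.model p).GtpYdd :=
  (ThetaSetting.model p).map_GtpYddN_eq_of_aug_of_GtpYN (inversion p) (aug_inversion p) (map_GtpYN_inversion p) 1

/-! ## §3. The finer root model: `ι` preserves `Π^tp_{Y_N}`, `Π^tp_{Z_N}`, `Π^tp_Ÿ` -/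

/-- `pr₂ (gfpInv γ) = (pr₂ γ)⁻¹`. [cite: MochizukiEtTh2009, §1 p.12] -/
theorem gfpSnd_gfpInv (γ : Gfp) : gfpSnd (gfpInv γ) = (gfpSnd γ)⁻¹ := rfl

/-- **The level maps intertwine the inversion with `negXY`**: `ĥ_N(pr₁ (gfpInv γ)) = negXY (ĥ_N (pr₁ γ))`.
[cite: MochizukiEtTh2009, Prop 2.2 (i) p.37] -/
theorem levelHom_gfpInv (N : ℕ+) (γ : Gfp) : levelHom N (gfpInv γ) = Heis.negXY (levelHom N γ) :=
  hHat_sigmaHat N _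

/-- `gfpInv` preserves `Δ^tp_{Y_N}`. [cite: MochizukiEtTh2009, §1 p.13] -/
theorem gfpInv_mem_dY_iff (N : ℕ+) (γ : Gfp) : gfpInv γ ∈ dY N ↔ γ ∈ dY N := by
  rw [dY, Subgroup.mem_inf, Subgroup.mem_inf, MonoidHom.mem_ker, MonoidHom.mem_ker, gfpSnd_gfpInv, inv_eq_one,
    Subgroup.mem_comap, Subgroup.mem_comap, levelHom_gfpInv, Heis.negXY_mem_zAxis_iff]

/-- `gfpInv` preserves `Δ^tp_{Z_N}`. [cite: MochizukiEtTh2009, §1 p.14] -/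
theorem gfpInv_mem_dZ_iff (N : ℕ+) (γ : Gfp) : gfpInv γ ∈ dZ N ↔ γ ∈ dZ N := by
  rw [dZ, Subgroup.mem_inf, Subgroup.mem_inf, MonoidHom.mem_ker, MonoidHom.mem_ker, gfpSnd_gfpInv, inv_eq_one,
    MonoidHom.mem_ker, MonoidHom.mem_ker, levelHom_gfpInv, Heis.negXY_eq_one_iff]

/-- **`ι(Π^tp_{Y_N}) = Π^tp_{Y_N}`** at the finer root model. [cite: MochizukiEtTh2009, §1 p.13] -/
theorem map_GtpYN_inversion₂ (N : ℕ+) :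
    ((ThetaSetting.model₂ p).GtpYN N).map (inversion₂ p).toMulEquiv.toMonoidHom = (ThetaSetting.model₂ p).GtpYN N :=
  map_eq_of_mem_iff _ _ fun x => by
    change inversionM₂ p x ∈ YN₂ p N ↔ x ∈ YN₂ p N
    rw [YN₂, Subgroup.mem_prod, Subgroup.mem_prod]
    exact and_congr (gfpInv_mem_dY_iff N x.1) Iff.rfl

/-- **`ι(Π^tp_{Z_N}) = Π^tp_{Z_N}`** at the finer root model. [cite: MochizukiEtTh2009, §1 p.14] -/
theorem map_GtpZN_inversion₂ (N : ℕ+) :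
    ((ThetaSetting.model₂ p).GtpZN N).map (inversion₂ p).toMulEquiv.toMonoidHom = (ThetaSetting.model₂ p).GtpZN N :=
  map_eq_of_mem_iff _ _ fun x => by
    change inversionM₂ p x ∈ ZN₂ p N ↔ x ∈ ZN₂ p N
    rw [ZN₂, Subgroup.mem_prod, Subgroup.mem_prod]
    exact and_congr (gfpInv_mem_dZ_iff N x.1) Iff.rfl

/-- **`ι(Π^tp_Ÿ) = Π^tp_Ÿ`** at the finer root model. [cite: Mochizuki2012, Rmk 1.4.1 (ii) p.28] -/
theorem map_GtpYdd_inversion₂ :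
    (ThetaSetting.model₂ p).GtpYdd.map (inversion₂ p).toMulEquiv.toMonoidHom = (ThetaSetting.model₂ p).GtpYdd :=
  (ThetaSetting.model₂ p).map_GtpYddN_eq_of_aug_of_GtpYN (inversion₂ p) (aug_inversion₂ p) (map_GtpYN_inversion₂ p) 1

/-- **Summary — the inversion of the finer model preserves the whole §1 covering tower** (`Y_N`, `Z_N` for all `N`, and `Ÿ`).
[cite: MochizukiEtTh2009, §1 p.13] -/
theorem inversion₂_preserves_coverings :
    (∀ N, ((ThetaSetting.model₂ p).GtpYN N).map (inversion₂ p).toMulEquiv.toMonoidHom = (ThetaSetting.model₂ p).GtpYN N) ∧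
    (∀ N, ((ThetaSetting.model₂ p).GtpZN N).map (inversion₂ p).toMulEquiv.toMonoidHom = (ThetaSetting.model₂ p).GtpZN N) ∧
    (ThetaSetting.model₂ p).GtpYdd.map (inversion₂ p).toMulEquiv.toMonoidHom = (ThetaSetting.model₂ p).GtpYdd :=
  ⟨map_GtpYN_inversion₂ p, map_GtpZN_inversion₂ p, map_GtpYdd_inversion₂ p⟩

end Literature.AnabelianGeometry.EtaleTheta.SettingModel

end
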